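import Summits.HodgeConjecture.HodgeConjecture.Theorems.Ring2AtlasCMSixfolds
import Literature.AlgebraicGeometry.Pohlmann1968.DegenerateCMTypeCyclotomic21
import Literature.AlgebraicGeometry.Pohlmann1968.HodgeClassesCMType
import Literature.AlgebraicGeometry.ComplexMultiplication.PrimitiveCMTypeSimple
import Literature.NumberTheory.ComplexMultiplication.CMTypeDictionary
import Literature.NumberTheory.NumberFields.EmbeddingSeparation
import Literature.AlgebraicGeometry.Deligne1982.WeilTypeCMHodgeRing
import Mathlib.NumberTheory.NumberField.Cyclotomic.Basic
import Mathlib.NumberTheory.NumberField.CMField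
import Mathlib.Analysis.SpecialFunctions.Trigonometric.Basic
import HarnessLib

set_option linter.dupNamespace false

/-!
# Ring 2 · atlas-2 — the DEGENERATE simple CM sixfold cell is NOT VACUOUS (given the realisation record)

HONEST FRAMING: research route conditional on HC_CM; not a corollary; Q11.4-sentence-2 already refuted in dim ≥ 3.

Cell `pub-hodge-ring2`, seat `pub-hodge-ring2-atlas-2` (generation 46). Companion of `Ring2AtlasCMSixfolds`
(generation 2: the row `g = 6`, simple, of CM-type, split into the OPEN degenerate cell
`HodgeDegenerateCMSixfold := HCOnClass fun A ↦ IsSimpleCMSixfold A ∧ HasBalancedQuadraticEndomorphism A` and the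
known-in-print nondegenerate cell) and of `Ring2AtlasCMSixfoldsNonVacuity` (generation 45: the ROW's class
`IsSimpleCMSixfold` is inhabited, by a NONDEGENERATE member, Shimura's primitive type on `ℚ(ζ₁₃)`). A class target
over an EMPTY class would be true for the wrong reason; this file proves that the class of the OPEN CELL itself is
inhabited, from the tree's existence record for CM abelian varieties:

* `exists_isSimpleCMSixfold_and_hasBalancedQuadraticEndomorphism_of_cmAbelianVarietyRealised :
    PicardCM.CMAbelianVarietyRealised → ∃ A, IsSimpleCMSixfold A ∧ HasBalancedQuadraticEndomorphism A`.

The hypothesis `PicardCM.CMAbelianVarietyRealised` (Shimura 1998 §6.2 Theorem 3, read on `H¹`) is the cell's standing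
realisation record `(h₃)`, an explicit ARGUMENT, never an axiom; `HC_CM` is not involved.

## The witness: the tree's primitive DEGENERATE type `(ℚ(ζ₂₁); Φ₂₁)` and the endomorphism `√-3 = 2ζ₂₁⁷ + 1`

`Literature/AlgebraicGeometry/Pohlmann1968/DegenerateCMTypeCyclotomic21` (sorry-free, no named fact) supplies the CM
type `Φ₂₁ = {σ_a | a ∈ {1,2,4,5,8,10} ⊂ (ℤ/21)ˣ}` of `L = ℚ(ζ₂₁)` (`[L:ℚ] = 12`), PRIMITIVE (`isPrimitive_Φ₂₁`, so
every realisation is SIMPLE, `isSimple_Φ₂₁`, Shimura §8.2 Prop. 26 via the tree theorem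
`isSimple_of_isCMTypeRealisation_of_primitive`), of dimension `6` (`dim_eq_six`), balanced `(3,3)` over
`ℚ(ζ₃) = ℚ(√-3)` (`fibres_balanced_Φ₂₁`: modulo `3` the exponents are `{1,4,10} ⊔ {2,5,8}`) and DEGENERATE as a
theorem (`cmTypeRank_Φ₂₁ : Rank(Φ₂₁) = 6`). What this file adds, to meet the cell's TYPED predicate
`HasBalancedQuadraticEndomorphism A := ∃ φ d, 0 < d ∧ φ ≫ φ = -d ∧ eigenMultiplicity A φ (i√d) = 3`:

1. (generic, any CM field `K`, any type `Φ`, any realisation `(A, ι, θ)` read on `H¹`) **the multiplicity of an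
   eigenvalue `ρ` of `ι(a)^*` on `H^{1,0}(A)` is the number of `σ ∈ Φ` with `σ(a) = ρ`**
   (`eigenMultiplicity_eq_ncard_of_isCMTypeRealisation`) — Shimura §5.2 «`δι(α)ω_i = α^{φ_i}ω_i (1 ≤ i ≤ n)` … the
   `ω_i` form a basis of `𝔇₀(A)`» (printed pp. 38–39; the clause of `PicardCM.CMAbelianVarietyRealised`), proved here
   on the carriers: in the eigenbasis `v_σ` of `H¹(A(ℂ); ℂ)` (`Pohlmann1968.exists_eigenbasis`) a class in
   `ker(ι(a)^* - ρ) ∩ H^{1,0}` has coefficients only on the `v_σ` with `σ(a) = ρ` (eigenvalue bookkeeping) and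
   `σ ∈ Φ` (coefficients of a `(1,0)`-class live on the `(1,0)`-vectors, `repr_eq_zero_of_hodgeType_ne`), and these
   `v_σ` lie in that intersection; so it is their span, of dimension their number.
2. (the witness) `α := 2ζ₂₁⁷ + 1 ∈ 𝓞_L` has `α² = -3` (`ζ₂₁⁷` is a primitive cube root of unity, `1 + ω + ω² = 0`), so
   `φ := ι(α)` satisfies `φ ≫ φ = -3`; under `σ_a` it goes to `2e^{2πi·7a/21} + 1`, which is `i√3 = 2e^{2πi/3} + 1`
   iff `7a ≡ 7 (mod 21)` iff `a ≡ 1 (mod 3)` (and `-i√3` otherwise); within `Φ₂₁` these are `a ∈ {1, 4, 10}`: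
   THREE of them (`decide` on `ℤ/21`). Hence `eigenMultiplicity A (ι α) (i√3) = 3` and
   `HasBalancedQuadraticEndomorphism A` with `d = 3` (`hasBalancedQuadraticEndomorphism_Φ₂₁`; no new definition is
   introduced — the element `2ζ₂₁⁷ + 1 ∈ 𝓞_L` is written out, `ζ₂₁ = IsCyclotomicExtension.zeta 21 ℚ L`).

Then `IsSimpleCMSixfold A` by `dim_eq_six`, `isSimple_Φ₂₁` and
`NumberTheory.ComplexMultiplication.isOfCMType_of_isCMTypeRealisation`, for any realisation `A` of
`(CyclotomicField 21 ℚ; Φ₂₁)` given by `(h₃)`.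

WHAT THIS IS NOT: no cell `def`, KIND, row word or count of `Ring2AtlasCMSixfolds` changes (PRINT 15 / CELL INFERENCE
10 untouched); nothing is claimed about the Hodge conjecture for the witness. For the record (cell docstring of
`HodgeDegenerateCMSixfold`, source-labelled there): the witness lies on the cyclotomic `ℤ₂ × ℤ₆` locus
`K ∈ {ℚ(ζ₂₁), ℚ(ζ₂₈), ℚ(ζ₃₆)}`, recorded as known in print MODULO the refereed tree fact
`Aoki2002_hodgeClasses_algebraic_fermatJacobianPowers` (every such type a translate of a Fermat type); the cell as a
whole stays `[status: open]`. Non-vacuity is all that is proved.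

References: [Shimura1998] G. Shimura, *Abelian Varieties with Complex Multiplication and Modular Functions*,
Princeton (1998), §5.2 (pp. 38–39), §6.2 Thm. 3, §8.2 Prop. 26; [MoonenZarhin1998WeilClasses] B. Moonen,
Yu. Zarhin, *Weil classes on abelian varieties*, J. reine angew. Math. 496 (1998), §1 (the multiplicities `n_σ`);
[vanGeemen1994HodgeAV] B. van Geemen, *An introduction to the Hodge conjecture for abelian varieties*, LNM 1594
(1994), 4.7 and Def. 4.9.
-/

noncomputable section

open CategoryTheory NumberField

namespace Summit.HodgeConjecture.HodgeConjecture.Ring2.Atlas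

open Literature.AlgebraicGeometry Literature.AlgebraicGeometry.Motives
open Literature.AlgebraicGeometry.HodgeTheory
open Literature.AlgebraicGeometry.ComplexMultiplication (IsCMTypeRealisation)
open Literature.NumberTheory.ComplexMultiplication (isOfCMType_of_isCMTypeRealisation)
open Literature.NumberTheory.Automorphic (PicardCM.CMAbelianVarietyRealised)
open Literature.NumberTheory.Automorphic.PicardCM (eigenline)
open Literature.AlgebraicGeometry.Milne1999 (IsOfCMType)
open Literature.AlgebraicGeometry.Pohlmann1968.Cyclotomic (rootζ z exp₂₁ exp₂₁_spec exp₂₁_injective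
  coprime_exp₂₁ exists_exp₂₁_eq S₂₁ Φ₂₁ isSimple_Φ₂₁ dim_eq_six)

/-! ## §1 The multiplicity of an eigenvalue of `ι(a)^*` on `H^{1,0}` of a CM realisation -/

section CMMultiplicity

variable {K : Type} [Field K] [NumberField K] {Φ : CMType K} {A : AbelianVariety ℂ}
  {ι : 𝓞 K →+* End A} {θ : K →+* Module.End ℂ (complexBetti A.X 1)}

/-- **Multiplicities on `H^{1,0}` of a CM realisation are counted on the type.** For a realisation
`(A, ι, θ)` of the CM type `(K; Φ)` read on `H¹` (`IsCMTypeRealisation`), `a ∈ 𝓞_K` and `ρ ∈ ℂ`: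
`dim_ℂ (ker(ι(a)^* - ρ) ∩ H^{1,0}(A)) = #{σ ∈ Φ | σ(a) = ρ}` — Shimura's «`δι(α)ω_i = α^{φ_i}ω_i (1 ≤ i ≤ n)`
… the `ω_i` form a basis of `𝔇₀(A)`», i.e. `H^{1,0} = ⊕_{σ ∈ Φ} H¹_σ` with `ι(a)` acting on the line `H¹_σ` by
`σ(a)` (Moonen–Zarhin's multiplicities `n_σ`). Proof on the carriers: eigenbasis `v_σ`
(`Pohlmann1968.exists_eigenbasis`); a class of `ker(ι(a)^* - ρ) ∩ H^{1,0}` has `v_σ`-coefficient `0` unless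
`σ(a) = ρ` (compare `ι(a)^* v = ρ v` coefficientwise) and unless `σ ∈ Φ` (`repr_eq_zero_of_hodgeType_ne`: a
`(1,0)`-class has no coefficient on the `(0,1)`-vectors `v_σ`, `σ ∉ Φ`); conversely those `v_σ` lie in the
intersection, so it is their span. [cite: Shimura1998, §5.2 pp. 38–39]
[cite: MoonenZarhin1998WeilClasses, §1 (the multiplicities n_σ)] -/
theorem eigenMultiplicity_eq_ncard_of_isCMTypeRealisation (hA : IsCMTypeRealisation Φ A ι θ)
    (a : 𝓞 K) (ρ : ℂ) :
    eigenMultiplicity A (ι a) ρ = {σ : K →+* ℂ | σ ∈ Φ.1 ∧ σ (a : K) = ρ}.ncard := by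
  classical
  haveI : Module.Finite ℂ (complexBetti A.X 1) := finite_complexBetti_abelianVariety A 1
  have hsp : IsSmoothProjective (Module.finrank ℚ K / 2) A.X := hA.1
  have hX : IsSmoothProjective A.dim A.X := Motives.AbelianVariety.isSmoothProjective_holds (A := A)
  have hdim : A.dim = Module.finrank ℚ K / 2 := Motives.schemeDim_eq_holds hsp
  have hσ := hA.2.2.2
  -- (1) the eigenbasis `v_σ` of `H¹(A(ℂ); ℂ)` and the Hodge types of its vectors
  obtain ⟨u, hu⟩ :=
    Literature.NumberTheory.NumberFields.exists_ringOfIntegers_separating_embeddings (F := K)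
  obtain ⟨b, hbθ⟩ := Pohlmann1968.exists_eigenbasis hA hu
  have hbmem : ∀ σ : K →+* ℂ, b σ ∈ eigenline θ σ := fun σ ↦
    (Submodule.mem_iInf _).2 fun x ↦ Module.End.mem_eigenspace_iff.2 (hbθ σ x)
  let tp : (K →+* ℂ) → ℕ × ℕ := fun σ ↦ if σ ∈ Φ.1 then (1, 0) else (0, 1)
  have htp : ∀ σ, (tp σ).1 + (tp σ).2 = 1 := fun σ ↦ by
    by_cases h : σ ∈ Φ.1 <;> simp [tp, h]
  have hvt : ∀ σ, IsOfHodgeType (Module.finrank ℚ K / 2) A.X 1 (tp σ).1 (tp σ).2 (b σ) := fun σ ↦ by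
    by_cases h : σ ∈ Φ.1
    · simp only [tp, h, if_true]
      exact (hσ σ).2.1 h (b σ) (hbmem σ)
    · simp only [tp, h, if_false]
      exact (hσ σ).2.2 h (b σ) (hbmem σ)
  -- (2) the intersection `ker(θ(a) - ρ) ∩ H^{1,0}` is the span of the `v_σ`, `σ ∈ Φ`, `σ(a) = ρ`
  set S : Set (K →+* ℂ) := {σ | σ ∈ Φ.1 ∧ σ (a : K) = ρ} with hS
  have key : Module.End.eigenspace (θ (a : K)) ρ ⊓ hodgeOneZero hsp =
      Submodule.span ℂ (Set.range fun s : S ↦ b s) := by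
    apply le_antisymm
    · intro v hv
      obtain ⟨hv1, hv2⟩ := Submodule.mem_inf.1 hv
      have hθv : θ (a : K) v = ρ • v := Module.End.mem_eigenspace_iff.1 hv1
      have hv2' : IsOfHodgeType (Module.finrank ℚ K / 2) A.X 1 1 0 v := (mem_hodgeOneZero hsp).1 hv2
      obtain ⟨c, hc⟩ : ∃ c : (K →+* ℂ) → ℂ, ⇑(b.repr v) = c := ⟨_, rfl⟩
      have hsum : v = ∑ σ, c σ • b σ := by
        rw [← hc]
        exact (b.sum_repr v).symm
      -- coefficients vanish off `σ(a) = ρ`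
      have hc1 : ∀ σ, σ (a : K) ≠ ρ → c σ = 0 := by
        have e1 : θ (a : K) v = ∑ σ, (c σ * σ (a : K)) • b σ := by
          rw [hsum, map_sum]
          refine Finset.sum_congr rfl fun σ _ ↦ ?_
          rw [map_smul, hbθ, smul_smul]
        have e2 : θ (a : K) v = ∑ σ, (ρ * c σ) • b σ := by
          rw [hθv, hsum, Finset.smul_sum]
          refine Finset.sum_congr rfl fun σ _ ↦ ?_
          rw [smul_smul]
        have h1 : ⇑(b.repr (θ (a : K) v)) = fun σ ↦ c σ * σ (a : K) := by
          rw [e1]; exact b.repr_sum_self _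
        have h2 : ⇑(b.repr (θ (a : K) v)) = fun σ ↦ ρ * c σ := by
          rw [e2]; exact b.repr_sum_self _
        intro σ hσa
        have h := congr_fun (h1.symm.trans h2) σ
        have h' : c σ * (σ (a : K) - ρ) = 0 := by
          rw [mul_sub, h]; ring
        rcases mul_eq_zero.1 h' with h0 | h0
        · exact h0
        · exact absurd (sub_eq_zero.1 h0) hσa
      -- coefficients vanish off `Φ`
      have hc2 : ∀ σ, σ ∉ Φ.1 → c σ = 0 := by
        intro σ hσΦ
        have h := repr_eq_zero_of_hodgeType_ne hsp b tp htp hvt (p := 1) (q := 0) (by norm_num) hv2'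
          (t := σ) (by simp [tp, hσΦ])
        rw [hc] at h
        exact h
      rw [hsum]
      refine Submodule.sum_mem _ fun σ _ ↦ ?_
      by_cases hσS : σ ∈ S
      · exact Submodule.smul_mem _ _ (Submodule.subset_span ⟨⟨σ, hσS⟩, rfl⟩)
      · have hcσ : c σ = 0 := by
          by_cases hσΦ : σ ∈ Φ.1
          · exact hc1 σ fun h ↦ hσS ⟨hσΦ, h⟩
          · exact hc2 σ hσΦ
        rw [hcσ, zero_smul]
        exact Submodule.zero_mem _
    · rw [Submodule.span_le]
      rintro _ ⟨s, rfl⟩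
      obtain ⟨hsΦ, hsa⟩ := s.2
      refine Submodule.mem_inf.2 ⟨Module.End.mem_eigenspace_iff.2 ?_, (mem_hodgeOneZero hsp).2 ?_⟩
      · rw [hbθ, hsa]
      · exact (hσ s).2.1 hsΦ (b s) (hbmem s)
  -- (3) count
  have hli : LinearIndependent ℂ fun s : S ↦ b s := b.linearIndependent.comp _ Subtype.val_injective
  unfold eigenMultiplicity
  rw [hA.2.2.1 a, ← Deligne1982.hodgeOneZero_eq_of_dim_eq hdim hsp hX, key, finrank_span_eq_card hli,
    ← Nat.card_eq_fintype_card, Nat.card_coe_set_eq]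

end CMMultiplicity

/-! ## §2 The witness: `(ℚ(ζ₂₁); Φ₂₁)` with `φ = ι(2ζ₂₁⁷ + 1)`, `φ² = -3`, multiplicity `3` at `i√3` -/

namespace Cyclotomic21

variable (L : Type) [Field L] [NumberField L] [IsCyclotomicExtension {21} ℚ L]

/-- **`(2t⁷ + 1)² = -3` for a primitive 21st root of unity `t`** (in any domain): `ω := t⁷` is a primitive cube
root of unity, `1 + ω + ω² = 0`, so `(2ω + 1)² = 4(ω² + ω + 1) - 3 = -3`. Applied below to
`t = ζ₂₁ ∈ 𝓞_{ℚ(ζ₂₁)}`: the witness endomorphism is `ι(2ζ₂₁⁷ + 1) = ι(√-3)`.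
[cite: vanGeemen1994HodgeAV, 4.7 and Def. 4.9] -/
theorem two_mul_pow_seven_add_one_mul_self {R : Type*} [CommRing R] [IsDomain R] {t : R}
    (ht : IsPrimitiveRoot t 21) : (2 * t ^ 7 + 1) * (2 * t ^ 7 + 1) = -3 := by
  have hω : IsPrimitiveRoot (t ^ 7) 3 := ht.pow (by norm_num) (by norm_num)
  have hsum := hω.geom_sum_eq_zero (by norm_num)
  simp only [Finset.sum_range_succ, Finset.sum_range_zero, zero_add, pow_zero, pow_one] at hsum
  linear_combination (4 : R) * hsum

/-- The integral element `2ζ₂₁⁷ + 1 ∈ 𝓞_L` (`ζ₂₁ = IsCyclotomicExtension.zeta 21 ℚ L` made integral by Mathlib's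
`IsPrimitiveRoot.toInteger`) is `2ζ₂₁⁷ + 1` in `L` (the tree's `Cyclotomic.z L = ζ₂₁`). [folklore] -/
theorem coe_two_mul_toInteger_pow_seven_add_one :
    (((2 * (IsCyclotomicExtension.zeta_spec 21 ℚ L).toInteger ^ 7 + 1 : 𝓞 L)) : L) = 2 * z L ^ 7 + 1 := by
  show algebraMap (𝓞 L) L (2 * (IsCyclotomicExtension.zeta_spec 21 ℚ L).toInteger ^ 7 + 1) = 2 * z L ^ 7 + 1
  rw [map_add, map_mul, map_pow, map_ofNat, map_one]
  rfl

/-- `e^{2πi/21}` is a primitive 21st root of unity in `ℂ`. [folklore] -/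
theorem isPrimitiveRoot_rootζ : IsPrimitiveRoot (rootζ 21) 21 := by
  simpa [rootζ] using Complex.isPrimitiveRoot_exp 21 (by norm_num)

/-- `(e^{2πi/21})²¹ = 1`. [folklore] -/
theorem rootζ_pow_twentyOne : rootζ 21 ^ 21 = 1 := (isPrimitiveRoot_rootζ).pow_eq_one

/-- **`2e^{2πi/3} + 1 = i√3`** (`e^{2πi/3} = -1/2 + i√3/2`). [folklore] -/
theorem two_mul_rootζ_pow_seven_add_one : 2 * rootζ 21 ^ 7 + 1 = Complex.I * (Real.sqrt 3 : ℂ) := by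
  have h7 : rootζ 21 ^ 7 = Complex.exp (↑(2 * Real.pi / 3) * Complex.I) := by
    rw [rootζ, ← Complex.exp_nat_mul]
    congr 1
    push_cast
    ring
  have hc : Real.cos (2 * Real.pi / 3) = -(1 / 2) := by
    rw [show 2 * Real.pi / 3 = Real.pi - Real.pi / 3 by ring, Real.cos_pi_sub, Real.cos_pi_div_three]
  have hs : Real.sin (2 * Real.pi / 3) = Real.sqrt 3 / 2 := by
    rw [show 2 * Real.pi / 3 = Real.pi - Real.pi / 3 by ring, Real.sin_pi_sub, Real.sin_pi_div_three]
  rw [h7, Complex.exp_mul_I, ← Complex.ofReal_cos, ← Complex.ofReal_sin, hc, hs]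
  push_cast
  ring

/-- `2e^{4πi/3} + 1 = -i√3` (the conjugate: `2ω² + 1 = -(2ω + 1)` from `1 + ω + ω² = 0`). [folklore] -/
theorem two_mul_rootζ_pow_fourteen_add_one : 2 * rootζ 21 ^ 14 + 1 = -(Complex.I * (Real.sqrt 3 : ℂ)) := by
  have hω : IsPrimitiveRoot (rootζ 21 ^ 7) 3 := isPrimitiveRoot_rootζ.pow (by norm_num) (by norm_num)
  have hsum := hω.geom_sum_eq_zero (by norm_num)
  simp only [Finset.sum_range_succ, Finset.sum_range_zero, zero_add, pow_zero, pow_one] at hsum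
  rw [← two_mul_rootζ_pow_seven_add_one, show (14 : ℕ) = 7 * 2 from rfl, pow_mul]
  linear_combination (2 : ℂ) * hsum

/-- `i√3 ≠ -i√3`. [folklore] -/
theorem neg_I_mul_sqrt_three_ne : -(Complex.I * (Real.sqrt 3 : ℂ)) ≠ Complex.I * (Real.sqrt 3 : ℂ) := by
  have hne : Complex.I * (Real.sqrt 3 : ℂ) ≠ 0 :=
    mul_ne_zero Complex.I_ne_zero
      (Complex.ofReal_ne_zero.2 (Real.sqrt_pos.2 (by norm_num : (0 : ℝ) < 3)).ne')
  intro h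
  exact hne (by linear_combination (-(1 : ℂ) / 2) * h)

/-- Residues: for a unit `e` of `ℤ/21`, `7e ≡ 7` or `14 (mod 21)`. Decided by the kernel. [folklore] -/
theorem seven_mul_val_mod (e : ZMod 21) (he : e.val.Coprime 21) :
    7 * e.val % 21 = 7 ∨ 7 * e.val % 21 = 14 := by
  revert e
  decide

/-- **`σ(2ζ₂₁⁷ + 1) = i√3 ⟺ 7e(σ) ≡ 7 (mod 21)`** for a complex embedding `σ` of `ℚ(ζ₂₁)` with exponent
`e(σ)` (`σ ζ₂₁ = e^{2πi e(σ)/21}`): `σ(2ζ₂₁⁷ + 1) = 2e^{2πi·7e(σ)/21} + 1` is `i√3` on the residues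
`e ≡ 1 (mod 3)` and `-i√3` on `e ≡ 2 (mod 3)`. [cite: vanGeemen1994HodgeAV, 4.7] -/
theorem apply_two_mul_zeta_pow_seven_add_one_eq_iff (σ : L →+* ℂ) :
    σ (2 * z L ^ 7 + 1) = Complex.I * (Real.sqrt 3 : ℂ) ↔ 7 * (exp₂₁ L σ).val % 21 = 7 := by
  have he := coprime_exp₂₁ L σ
  rw [map_add, map_mul, map_pow, map_ofNat, map_one, exp₂₁_spec L σ, ← pow_mul',
    pow_eq_pow_mod (7 * (exp₂₁ L σ).val) rootζ_pow_twentyOne]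
  rcases seven_mul_val_mod (exp₂₁ L σ) he with h | h
  · rw [h]
    exact iff_of_true two_mul_rootζ_pow_seven_add_one rfl
  · rw [h, two_mul_rootζ_pow_fourteen_add_one]
    exact iff_of_false neg_I_mul_sqrt_three_ne (by norm_num)

/-- Counting embeddings of `ℚ(ζ₂₁)` through their exponents: `#{σ | Q(e(σ))} = #{c ∈ (ℤ/21)ˣ | Q(c)}` (`σ ↦ e(σ)`
is a bijection onto the units; the tree's `exp₂₁_injective`, `exists_exp₂₁_eq`, `coprime_exp₂₁`). [folklore] -/
theorem ncard_setOf_exp₂₁ (Q : ZMod 21 → Prop) [DecidablePred Q] :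
    {σ : L →+* ℂ | Q (exp₂₁ L σ)}.ncard =
      (Finset.univ.filter fun c : ZMod 21 ↦ c.val.Coprime 21 ∧ Q c).card := by
  rw [← Set.ncard_image_of_injective {σ : L →+* ℂ | Q (exp₂₁ L σ)} (exp₂₁_injective L),
    ← Set.ncard_coe_finset]
  congr 1
  ext c
  simp only [Set.mem_image, Set.mem_setOf_eq, Finset.coe_filter, Finset.mem_univ, true_and]
  constructor
  · rintro ⟨σ, hQ, rfl⟩
    exact ⟨coprime_exp₂₁ L σ, hQ⟩
  · rintro ⟨hc, hQ⟩
    obtain ⟨σ, rfl⟩ := exists_exp₂₁_eq L c hc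
    exact ⟨σ, hQ, rfl⟩

/-- **Within `Φ₂₁ = {1,2,4,5,8,10}` exactly THREE exponents are `≡ 1 (mod 3)`** (namely `1, 4, 10`): the type is
balanced `(3,3)` over `ℚ(√-3)`. Decided by the kernel on `ℤ/21`. [cite: vanGeemen1994HodgeAV, Def. 4.9] -/
theorem card_balanced :
    (Finset.univ.filter fun c : ZMod 21 ↦ c.val.Coprime 21 ∧ (c ∈ S₂₁ ∧ 7 * c.val % 21 = 7)).card = 3 := by
  decide

variable {L} {A : AbelianVariety ℂ} {ι : 𝓞 L →+* End A} {θ : L →+* Module.End ℂ (complexBetti A.X 1)}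

/-- **The eigenvalue `i√3` of `ι(α)^*` has multiplicity `3` on `H^{1,0}(A)`** for every realisation `A` of
`(ℚ(ζ₂₁); Φ₂₁)`, where `α = 2ζ₂₁⁷ + 1 ∈ 𝓞_{ℚ(ζ₂₁)}` (`eigenMultiplicity_eq_ncard_of_isCMTypeRealisation` +
`apply_two_mul_zeta_pow_seven_add_one_eq_iff` + `card_balanced`).
[cite: MoonenZarhin1998WeilClasses, §1 (the multiplicities n_σ)] [cite: vanGeemen1994HodgeAV, 4.7 and Def. 4.9] -/
theorem eigenMultiplicity_ι_two_mul_zeta_pow_seven_add_one (hA : IsCMTypeRealisation (Φ₂₁ L) A ι θ) :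
    eigenMultiplicity A (ι (2 * (IsCyclotomicExtension.zeta_spec 21 ℚ L).toInteger ^ 7 + 1))
      (Complex.I * (Real.sqrt ((3 : ℕ) : ℝ) : ℂ)) = 3 := by
  have hset : {σ : L →+* ℂ | σ ∈ (Φ₂₁ L).1 ∧
      σ (((2 * (IsCyclotomicExtension.zeta_spec 21 ℚ L).toInteger ^ 7 + 1 : 𝓞 L)) : L) =
        Complex.I * (Real.sqrt 3 : ℂ)} =
      {σ : L →+* ℂ | exp₂₁ L σ ∈ S₂₁ ∧ 7 * (exp₂₁ L σ).val % 21 = 7} := by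
    ext σ
    rw [Set.mem_setOf_eq, Set.mem_setOf_eq, coe_two_mul_toInteger_pow_seven_add_one,
      apply_two_mul_zeta_pow_seven_add_one_eq_iff]
    exact Iff.rfl
  rw [show ((3 : ℕ) : ℝ) = 3 by norm_num, eigenMultiplicity_eq_ncard_of_isCMTypeRealisation hA, hset,
    ncard_setOf_exp₂₁ L (fun c ↦ c ∈ S₂₁ ∧ 7 * c.val % 21 = 7), card_balanced]

/-- **Every realisation of `(ℚ(ζ₂₁); Φ₂₁)` has a balanced quadratic endomorphism**: `φ = ι(2ζ₂₁⁷ + 1)`, `d = 3`,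
`φ ≫ φ = ι(α²) = -3`, multiplicity of `i√3` on `H^{1,0}` equal to `3` — the cell's typed `k`-Weil `(3,3)` predicate
for `k = ℚ(√-3) ⊂ ℚ(ζ₂₁)`. [cite: MoonenZarhin1998WeilClasses, §1 (the multiplicities n_σ)]
[cite: vanGeemen1994HodgeAV, 4.7 and Def. 4.9] -/
theorem hasBalancedQuadraticEndomorphism_Φ₂₁ (hA : IsCMTypeRealisation (Φ₂₁ L) A ι θ) :
    HasBalancedQuadraticEndomorphism A := by
  refine ⟨ι (2 * (IsCyclotomicExtension.zeta_spec 21 ℚ L).toInteger ^ 7 + 1), 3, by norm_num, ?_,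
    eigenMultiplicity_ι_two_mul_zeta_pow_seven_add_one hA⟩
  change ι (2 * (IsCyclotomicExtension.zeta_spec 21 ℚ L).toInteger ^ 7 + 1) *
      ι (2 * (IsCyclotomicExtension.zeta_spec 21 ℚ L).toInteger ^ 7 + 1) = -((3 : ℕ) • (1 : End A))
  rw [← map_mul, two_mul_pow_seven_add_one_mul_self
    (IsCyclotomicExtension.zeta_spec 21 ℚ L).toInteger_isPrimitiveRoot, map_neg, map_ofNat, nsmul_eq_mul,
    Nat.cast_ofNat, mul_one]

end Cyclotomic21

open Cyclotomic21 in
/-- **NON-VACUITY OF THE OPEN CELL `g = 6`, simple, CM-type, DEGENERATE.** Given the realisation record for CM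
abelian varieties (`PicardCM.CMAbelianVarietyRealised`, Shimura 1998 §6.2 Thm. 3, an explicit hypothesis), there is
a complex abelian variety `A` with `A.dim = 6`, `A` simple, of CM-type, AND carrying an endomorphism `φ` with
`φ ≫ φ = -3` whose eigenvalue `i√3` has multiplicity `3` on `H^{1,0}(A)` — namely any realisation of the tree's
primitive degenerate type `(ℚ(ζ₂₁); Φ₂₁)` (`Pohlmann1968/DegenerateCMTypeCyclotomic21`: simple by `isSimple_Φ₂₁`,
dimension `6` by `dim_eq_six`; of CM-type by `isOfCMType_of_isCMTypeRealisation`; the endomorphism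
`ι(2ζ₂₁⁷ + 1)` by `hasBalancedQuadraticEndomorphism_Φ₂₁`). So the class target `HodgeDegenerateCMSixfold`
quantifies over a nonempty class. [cite: Shimura1998, §6.2 Thm. 3; §8.2 Prop. 26; §5.2 pp. 38–39]
[cite: MoonenZarhin1998WeilClasses, §1 (the multiplicities n_σ)] -/
theorem exists_isSimpleCMSixfold_and_hasBalancedQuadraticEndomorphism_of_cmAbelianVarietyRealised
    (h₃ : PicardCM.CMAbelianVarietyRealised) :
    ∃ A : AbelianVariety ℂ, IsSimpleCMSixfold A ∧ HasBalancedQuadraticEndomorphism A := by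
  haveI : IsCyclotomicExtension {21} ℚ (CyclotomicField 21 ℚ) := CyclotomicField.isCyclotomicExtension 21 ℚ
  haveI : NumberField (CyclotomicField 21 ℚ) := IsCyclotomicExtension.numberField {21} ℚ _
  haveI : IsCMField (CyclotomicField 21 ℚ) :=
    IsCyclotomicExtension.Rat.isCMField (CyclotomicField 21 ℚ) (S := ({21} : Set ℕ)) ⟨21, rfl, by norm_num⟩
  obtain ⟨A, ι, θ, hA⟩ := h₃ (CyclotomicField 21 ℚ) (Φ₂₁ (CyclotomicField 21 ℚ))
  have hA' : IsCMTypeRealisation (Φ₂₁ (CyclotomicField 21 ℚ)) A ι θ := hA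
  exact ⟨A, ⟨dim_eq_six hA', isSimple_Φ₂₁ hA', isOfCMType_of_isCMTypeRealisation hA'⟩,
    hasBalancedQuadraticEndomorphism_Φ₂₁ hA'⟩

/-- Hence the class of the open cell target `HodgeDegenerateCMSixfold = HCOnClass (IsSimpleCMSixfold ∧
HasBalancedQuadraticEndomorphism)` is nonempty: the cell is not vacuously true. [folklore] -/
theorem hodgeDegenerateCMSixfold_class_nonempty (h₃ : PicardCM.CMAbelianVarietyRealised) :
    {A : AbelianVariety ℂ | IsSimpleCMSixfold A ∧ HasBalancedQuadraticEndomorphism A}.Nonempty :=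
  exists_isSimpleCMSixfold_and_hasBalancedQuadraticEndomorphism_of_cmAbelianVarietyRealised h₃

end Summit.HodgeConjecture.HodgeConjecture.Ring2.Atlas

end
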